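import Summits.CriticalPhenomena.Ising3D.TaylorTableHeads
import Summits.CriticalPhenomena.Ising3D.TaylorTableEvenHeadPartsE
import Summits.CriticalPhenomena.Ising3D.TaylorTableEvenHeadDeltaCells
import Mathlib.Tactic.Linarith
import HarnessLib

/-!
# The TABLE layer of a derivative certificate, XXI: `TaylorTable.EvenHeads` from a FAST head certificate (table-level wiring)
(cell `pub-ising3x`, seat boot-1 gen 8; gate (g2) — the even head layer of a kernel-replayed box certificate, end to end)

HONEST FRAMING: lottery ticket; floor = tightest certified 3D Ising CFT bounds; no exact-solution
claim without a proof. Island framing: certified exclusion region at stated derivative order and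
assumptions; not a determination of the 3D Ising critical exponents beyond that.

The glue between the table `T : TaylorTable` (whose `evenCells` list the even head cells the cover check
`checkEvenCover` refers to) and the FAST per-cell theorems: a head certificate lists, ALIGNED with `T.evenCells`, one
Taylor-model cell `EvenCellTM` (same spin, same head list, a `Δ`-interval containing the table cell, `ℓ ≤ lo`), a
bisection depth and the claimed parts; `TaylorTable.evenMatchOK` decides the alignment; the rows are ONE row object for
the whole table (`HeadRowsΔ` with `ValidΔ` for wide boxes — discharged from the certificate's literal δ-tables by
`HeadRowsΔ.validΔ_of_lit`; `EvenRows` with `ValidE` for point / very narrow boxes — `EvenRows.validE_of_tables`).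
**`TaylorTable.evenHeads_of_certΔ`** / **`TaylorTable.evenHeads_of_certE`**: structural cell checks + alignment + row
validity + every part check (one kernel declaration per `(cell, part)`) + every final check (one per cell) ⇒
`T.EvenHeads`, the hypothesis of `TaylorTable.boxExcluded_of_taylorTable_heads`. A certificate file then composes
`boxExcluded_of_taylorTable_heads h (evenHeads_of_certΔ …) hOdd hRegion hCone` with the region routes of recog-1
(`TaylorTable.evenRegion_of_splitΔL…`, `oddCone_of_splitΔL…`). The odd head layer (`T.OddHeads`) still has only the
kd-tree route (`oddHeads_of_kdCheck`); its Taylor-model twin is the remaining head-layer file. No new mathematics.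
Sources: Kos–Poland–Simmons-Duffin 2014 §3.3 eq. (3.16). [folklore]
-/

namespace Summit.CriticalPhenomena.Ising3D

open Finset Set
open Literature.Analysis.ValidatedNumerics Literature.Analysis.ValidatedNumerics.PolyMP
open Literature.MathematicalPhysics.QuantumFieldTheory.ConformalBootstrap3D

/-- The empty Taylor-model cell (default for out-of-range indices). [folklore] -/
def EvenCellTM.empty : EvenCellTM := ⟨0, 0, 0, 0, []⟩

/-- The empty part (default). [folklore] -/
def HeadPart3.empty : HeadPart3 := ⟨0, 0, ([], [], []), ([], [], []), ([], [], [])⟩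

/-- The empty part (default), zeroth-order shape. [folklore] -/
def HeadPart.empty : HeadPart := ⟨0, 0, [], [], []⟩

/-- Alignment of ONE table cell with ONE Taylor-model cell: same spin, same head list, the model cell contains the
table cell, and `ℓ ≤ lo` for the model cell. [folklore] -/
def evenCellMatch (C : EvenCellData) (C' : EvenCellTM) : Bool :=
  decide (C'.ℓ = C.ℓ) && decide (C'.F = C.F) && decide (C'.lo ≤ C.lo) && decide (C.hi ≤ C'.hi) &&
    decide ((C'.ℓ : ℚ) ≤ C'.lo)

/-- [folklore] -/
theorem evenCellMatch_spec {C : EvenCellData} {C' : EvenCellTM} (h : evenCellMatch C C' = true) :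
    C'.ℓ = C.ℓ ∧ C'.F = C.F ∧ C'.lo ≤ C.lo ∧ C.hi ≤ C'.hi ∧ (C'.ℓ : ℚ) ≤ C'.lo := by
  simpa [evenCellMatch, Bool.and_eq_true, decide_eq_true_eq, and_assoc] using h

/-! ### Wide boxes: δ-expanded head certificate -/

/-- A FAST even head certificate for a wide box: one δ-row object and, aligned with the table's even cells, a
Taylor-model cell, a bisection depth and the claimed part triples. [folklore] -/
structure EvenHeadCertΔ where
  /-- the δ-expanded rows (shared with the region layer's literal `L`) -/
  R : HeadRowsΔ
  /-- per table cell: model cell, bisection depth, parts -/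
  cells : List (EvenCellTM × ℕ × List HeadPart3)

namespace EvenHeadCertΔ

variable (H : EvenHeadCertΔ)

/-- Model cell `i`. [folklore] -/
def cellTM (i : ℕ) : EvenCellTM := (H.cells.getD i (EvenCellTM.empty, 0, [])).1
/-- Bisection depth of cell `i`. [folklore] -/
def celldP (i : ℕ) : ℕ := (H.cells.getD i (EvenCellTM.empty, 0, [])).2.1
/-- Parts of cell `i`. [folklore] -/
def cellParts (i : ℕ) : List HeadPart3 := (H.cells.getD i (EvenCellTM.empty, 0, [])).2.2
/-- Number of parts of cell `i`. [folklore] -/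
def numParts (i : ℕ) : ℕ := (H.cellParts i).length
/-- Part `k` of cell `i`. [folklore] -/
def part (i k : ℕ) : HeadPart3 := (H.cellParts i).getD k HeadPart3.empty

/-- **Part check `(i, k)`** — ONE kernel declaration of a certificate file each. [folklore] -/
def partOK (i k : ℕ) : Bool := evenHeadPartOKΔ H.R (H.cellTM i) (H.part i k)

/-- **Final check of cell `i`** — one declaration each. [folklore] -/
def finalOK (i : ℕ) : Bool := evenHeadPartsFinalOKΔ H.R (H.celldP i) (H.cellTM i) (H.cellParts i)

end EvenHeadCertΔ

namespace TaylorTable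

variable (T : TaylorTable)

/-- Alignment of the table's even cells with the certificate's model cells (equal lengths, cellwise `evenCellMatch`).
[folklore] -/
def evenMatchOKΔ (H : EvenHeadCertΔ) : Bool :=
  decide (H.cells.length = T.evenCells.length) &&
    (List.range T.evenCells.length).all fun i =>
      match T.evenCells[i]? with
      | some C => evenCellMatch C (H.cellTM i)
      | none => false

/-- **`EvenHeads` from a δ-expanded FAST head certificate.** Structural cell checks (part of `T.checkS`), alignment,
δ-row validity on the table's box, all part checks and all final checks ⇒ the even head layer of the table.
[cite: KosPolandSimmonsduffin2014, §3.3 eq. (3.16)] -/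
theorem evenHeads_of_certΔ (H : EvenHeadCertΔ) (hS : T.evenCells.all T.checkEvenCellS = true)
    (hm : T.evenMatchOKΔ H = true) (hV : H.R.ValidΔ T.c T.L T.σlo T.σhi T.εlo T.εhi)
    (hparts : ∀ i k : ℕ, i < T.evenCells.length → k < H.numParts i → H.partOK i k = true)
    (hfinal : ∀ i : ℕ, i < T.evenCells.length → H.finalOK i = true) : T.EvenHeads := by
  intro C hC p hp Δ hlo hhi a b
  obtain ⟨i, hi, hCi⟩ := List.getElem_of_mem hC
  simp only [evenMatchOKΔ, Bool.and_eq_true, decide_eq_true_eq, List.all_eq_true, List.mem_range] at hm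
  obtain ⟨_, hall⟩ := hm
  have hmi := hall i hi
  rw [List.getElem?_eq_getElem hi, hCi] at hmi
  obtain ⟨hℓ, hF, hlo', hhi', hℓlo⟩ := evenCellMatch_spec hmi
  rw [List.all_eq_true] at hS
  have hcell := hS C hC
  simp only [checkEvenCellS, Bool.and_eq_true, decide_eq_true_eq, List.all_eq_true] at hcell
  obtain ⟨⟨⟨hFnd, hFj⟩, _⟩, _⟩ := hcell
  have hFnd' : (H.cellTM i).F.Nodup := by rw [hF]; exact hFnd
  have hFj' : ∀ q ∈ (H.cellTM i).F, q.2 ≤ (H.cellTM i).ℓ + q.1 := by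
    rw [hF, hℓ]; exact fun q hq => hFj q hq
  have hparts' : ∀ p' ∈ H.cellParts i, evenHeadPartOKΔ H.R (H.cellTM i) p' = true := by
    intro p' hp'
    obtain ⟨k, hk, hpk⟩ := List.getElem_of_mem hp'
    have h := hparts i k hi hk
    simp only [EvenHeadCertΔ.partOK, EvenHeadCertΔ.part, List.getD_eq_getElem _ _ hk, hpk] at h
    exact h
  have hlo'' : ((H.cellTM i).lo : ℝ) ≤ Δ := le_trans (by exact_mod_cast hlo') hlo
  have hhi'' : Δ ≤ ((H.cellTM i).hi : ℝ) := le_trans hhi (by exact_mod_cast hhi')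
  have h := evenHead_nonneg_of_partsΔ T.c hFnd' hFj' hℓlo hV hparts' (hfinal i hi) p hp Δ hlo'' hhi'' a b
  rw [hF, hℓ] at h
  exact h

end TaylorTable

/-! ### Point / very narrow boxes: zeroth-order rows from literal `(P, D)` tables -/

/-- A FAST even head certificate with zeroth-order rows (`EvenRows`, contract `ValidE`). [folklore] -/
structure EvenHeadCertE where
  /-- the interval rows -/
  R : EvenRows
  /-- per table cell: model cell, bisection depth, parts -/
  cells : List (EvenCellTM × ℕ × List HeadPart)

namespace EvenHeadCertE

variable (H : EvenHeadCertE)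

/-- Model cell `i`. [folklore] -/
def cellTM (i : ℕ) : EvenCellTM := (H.cells.getD i (EvenCellTM.empty, 0, [])).1
/-- Bisection depth of cell `i`. [folklore] -/
def celldP (i : ℕ) : ℕ := (H.cells.getD i (EvenCellTM.empty, 0, [])).2.1
/-- Parts of cell `i`. [folklore] -/
def cellParts (i : ℕ) : List HeadPart := (H.cells.getD i (EvenCellTM.empty, 0, [])).2.2
/-- Number of parts of cell `i`. [folklore] -/
def numParts (i : ℕ) : ℕ := (H.cellParts i).length
/-- Part `k` of cell `i`. [folklore] -/
def part (i k : ℕ) : HeadPart := (H.cellParts i).getD k HeadPart.empty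

/-- **Part check `(i, k)`** — one declaration each. [folklore] -/
def partOK (i k : ℕ) : Bool := evenHeadPartOK H.R (H.cellTM i) (H.part i k)

/-- **Final check of cell `i`** — one declaration each. [folklore] -/
def finalOK (i : ℕ) : Bool := evenHeadPartsFinalOK H.R (H.celldP i) (H.cellTM i) (H.cellParts i)

end EvenHeadCertE

namespace TaylorTable

variable (T : TaylorTable)

/-- Alignment, zeroth-order certificate. [folklore] -/
def evenMatchOKE (H : EvenHeadCertE) : Bool :=
  decide (H.cells.length = T.evenCells.length) &&
    (List.range T.evenCells.length).all fun i =>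
      match T.evenCells[i]? with
      | some C => evenCellMatch C (H.cellTM i)
      | none => false

/-- **`EvenHeads` from a zeroth-order FAST head certificate** (point / very narrow boxes; rows e.g. by
`EvenRows.validE_of_tables`). [cite: KosPolandSimmonsduffin2014, §3.3 eq. (3.16)] -/
theorem evenHeads_of_certE (H : EvenHeadCertE) (hS : T.evenCells.all T.checkEvenCellS = true)
    (hm : T.evenMatchOKE H = true) (hV : H.R.ValidE T.c T.L T.σlo T.σhi T.εlo T.εhi)
    (hparts : ∀ i k : ℕ, i < T.evenCells.length → k < H.numParts i → H.partOK i k = true)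
    (hfinal : ∀ i : ℕ, i < T.evenCells.length → H.finalOK i = true) : T.EvenHeads := by
  intro C hC p hp Δ hlo hhi a b
  obtain ⟨i, hi, hCi⟩ := List.getElem_of_mem hC
  simp only [evenMatchOKE, Bool.and_eq_true, decide_eq_true_eq, List.all_eq_true, List.mem_range] at hm
  obtain ⟨_, hall⟩ := hm
  have hmi := hall i hi
  rw [List.getElem?_eq_getElem hi, hCi] at hmi
  obtain ⟨hℓ, hF, hlo', hhi', hℓlo⟩ := evenCellMatch_spec hmi
  rw [List.all_eq_true] at hS
  have hcell := hS C hC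
  simp only [checkEvenCellS, Bool.and_eq_true, decide_eq_true_eq, List.all_eq_true] at hcell
  obtain ⟨⟨⟨hFnd, hFj⟩, _⟩, _⟩ := hcell
  have hFnd' : (H.cellTM i).F.Nodup := by rw [hF]; exact hFnd
  have hFj' : ∀ q ∈ (H.cellTM i).F, q.2 ≤ (H.cellTM i).ℓ + q.1 := by
    rw [hF, hℓ]; exact fun q hq => hFj q hq
  have hparts' : ∀ p' ∈ H.cellParts i, evenHeadPartOK H.R (H.cellTM i) p' = true := by
    intro p' hp'
    obtain ⟨k, hk, hpk⟩ := List.getElem_of_mem hp'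
    have h := hparts i k hi hk
    simp only [EvenHeadCertE.partOK, EvenHeadCertE.part, List.getD_eq_getElem _ _ hk, hpk] at h
    exact h
  have hlo'' : ((H.cellTM i).lo : ℝ) ≤ Δ := le_trans (by exact_mod_cast hlo') hlo
  have hhi'' : Δ ≤ ((H.cellTM i).hi : ℝ) := le_trans hhi (by exact_mod_cast hhi')
  have h := evenHead_nonneg_of_parts_E T.c hFnd' hFj' hℓlo hV hparts' (hfinal i hi) p hp Δ hlo'' hhi'' a b
  rw [hF, hℓ] at h
  exact h

/-- **The box-exclusion capstone with a δ-expanded FAST even head certificate** (odd head layer, region layers as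
named hypotheses — any route). [cite: KosPolandSimmonsduffin2014, §3.3 eq. (3.16)] -/
theorem boxExcluded_of_taylorTable_evenCertΔ (h : T.checkS = true) (H : EvenHeadCertΔ)
    (hm : T.evenMatchOKΔ H = true) (hV : H.R.ValidΔ T.c T.L T.σlo T.σhi T.εlo T.εhi)
    (hparts : ∀ i k : ℕ, i < T.evenCells.length → k < H.numParts i → H.partOK i k = true)
    (hfinal : ∀ i : ℕ, i < T.evenCells.length → H.finalOK i = true)
    (hOH : T.OddHeads) (hR : TaylorEvenRegion T.α T.box ((T.E₀ : ℚ) : ℝ)) (hC : T.OddCone) :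
    BoxExcluded T.box := by
  have h' := h
  simp only [checkS, Bool.and_eq_true] at h'
  obtain ⟨⟨⟨⟨⟨_, _⟩, hEcells⟩, _⟩, _⟩, _⟩ := h'
  exact T.boxExcluded_of_taylorTable_heads h (T.evenHeads_of_certΔ H hEcells hm hV hparts hfinal) hOH hR hC

end TaylorTable

end Summit.CriticalPhenomena.Ising3D
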